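import Summits.KontsevichZagierPeriods.KontsevichZagierPeriods.Theorems.FurushoPentagonDoubleShuffleInKZRiderStep
import Summits.KontsevichZagierPeriods.KontsevichZagierPeriods.Theorems.FurushoPentagonDoubleShuffleInKZStarSum
import Summits.KontsevichZagierPeriods.KontsevichZagierPeriods.Theorems.FurushoPentagonDoubleShuffleInKZLambdaCells
import Summits.KontsevichZagierPeriods.KontsevichZagierPeriods.Theorems.FurushoPentagonDoubleShuffleInKZLambdaChart
import Summits.KontsevichZagierPeriods.KontsevichZagierPeriods.Theorems.FurushoPentagonDoubleShuffleInKZIntegralSeries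
import Summits.KontsevichZagierPeriods.KontsevichZagierPeriods.Theorems.FurushoPentagonHoffmanRelationInKZCubicalTransport

/-!
# `DoubleShuffleInKZ` (stmt-KontsevichZagierPeriods-14665, route `FurushoPentagon`): the proof

`DoubleShuffleInKZ` — Racinet's generalised double shuffle relations hold for the image of the
shuffle-regularised MZV series under every additive map `χ : KZ.FormalRep →+ R` that kills the
Kontsevich–Zagier relation module, is multiplicative and hits `1` — is proved here, closing the
support item of the route `FurushoPentagon`.

The proof (line "rider lever").  By `IntegralSeries.doubleShuffleInKZ_of_integralSeriesFamily`
(the algebraic reduction: Hoffman's relation + finite double shuffle for admissible pairs, both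
already in the KZ module, plus Ihara–Kaneko–Zagier's bookkeeping) it suffices to put the
Kaneko–Yamamoto integral–series family
`IS_j(b, t) : Σ_{w ∈ yʲ ш tail(bw((b+1)∷t))} Z(x w) ≡ Σ_{c ∈ (1^{j+1})^⋆} Σ_{stuffle} Z((b + c₀) ∷ …)`
inside `KZ.relations`, for every pinned family `Z` of Kontsevich simplex representations.  Both
sides are congruent to ONE absolutely convergent mixed representation `C_j((b+1)∷t, 0)`
(`j` increasing riders `0 < v₀ < ⋯ < v_{j-1} < x₀` in front of the cubical word block):
* the stuffle side by THE INDUCTION ON THE NUMBER OF RIDERS `rider_induction` proved first in this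
  file: for every `j`, every non-empty admissible `w` and every block `m`, the mixed representation
  `C_j(w, m) = [{x ∈ (0,1)ⁿ, 0 < v₀ < ⋯ < v_{j-1} < 1, v_{j-1} < x_{p_m}}, f_w(x) ∏_{a<j} 1/(1 − v_a)]`
  exists and is congruent to the closed star–stuffle form of its series,
  `G_j(Z; w, m) = Σ_{c ∈ (1^{j+1})⋆} Σ_{v ∈ w_{>m} ∗ c.tail} Z(w_{<m} ++ (w_m − 1 + c₁) :: v)`
  (base `j = 0`: Kontsevich's cubical transport `HoffmanRelationInKZ.stub_cubicalTransport`; step: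
  `rider_step` — Hoffman's dilation lever at a general block with a passive rider chain, then the
  block dissection — and the recursion `star_step_identity` of the closed form);
* the shuffle side by `lambda_chart` (monomial chart on the word block + relabelling to the
  `Λ`-poset shape) and `lambda_cells` (fibred shuffle-cell dissection of the `Λ`-poset
  representation into the Kontsevich simplices of the words `x w`, `w ∈ yʲ ш tail`).

References: M. Kontsevich, D. Zagier, *Periods* (2001), §1.2; K. Ihara, M. Kaneko, D. Zagier,
Compositio Math. 142 (2006), Thm 2; M. Kaneko, S. Yamamoto, Selecta Math. 24 (2018), Thm 4.1;
G. Racinet, Publ. Math. IHÉS 95 (2002); H. Furusho, Ann. of Math. 174 (2011).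
-/

noncomputable section

open Set MeasureTheory Function
open Literature.NumberTheory.Transcendental
open Literature.NumberTheory.Transcendental.MZV (starIndices sumStuffle)
open Summit.KontsevichZagierPeriods.FurushoPentagon.HoffmanRelationInKZ

namespace Summit.KontsevichZagierPeriods.FurushoPentagon.DoubleShuffleInKZ

/-! ### The base: no riders -/

/-- **Base of the rider induction** (`j = 0`): the cubical representation `[(0,1)ⁿ, f_w]`, read as a
mixed representation with no riders (dimension `0 + n`), exists and is congruent to `Z w` for every
pinned `Z` (`HoffmanRelationInKZ.stub_cubicalTransport`: the monomial chart onto Kontsevich's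
simplex; one reindexing along `Fin n ≃ Fin (0 + n)`). [cite: KontsevichZagier2001, §1.2] -/
theorem rider_base (Z : List ℕ → KZ.FormalRep)
    (hZ : ∀ (u : List ℕ) (hu : MZV.IsAdmissible u), Z u = KZ.of (KZ.mzvRep u hu
      (KZ.mzvIntegrand_isSemialgebraicFunOn_holds u) (KZ.mzvIntegrand_integrableOn_holds u hu)))
    (w : List ℕ) (hw : MZV.IsAdmissible w) (hne : w ≠ []) (m : ℕ) :
    (∃ r : KZ.IntegralRep (0 + MZV.weight w),
      r.domain = {z : Fin (0 + MZV.weight w) → ℝ |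
        (∀ i : Fin (MZV.weight w), z (Fin.natAdd 0 i) ∈ Set.Ioo (0:ℝ) 1) ∧
        (∀ a : Fin 0, z (Fin.castAdd (MZV.weight w) a) ∈ Set.Ioo (0:ℝ) 1) ∧
        (∀ a b : Fin 0, a < b → z (Fin.castAdd (MZV.weight w) a) < z (Fin.castAdd (MZV.weight w) b)) ∧
        (∀ a : Fin 0, (a : ℕ) + 1 = 0 → ∀ i : Fin (MZV.weight w), (i : ℕ) = (w.take m).sum →
          z (Fin.castAdd (MZV.weight w) a) < z (Fin.natAdd 0 i))} ∧
      Set.EqOn r.integrand (fun z => (∏ l : Fin w.length,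
        (∏ t : Fin (MZV.weight w), if (t : ℕ) < (w.take l).sum then z (Fin.natAdd 0 t) else 1) /
        (1 - (∏ t : Fin (MZV.weight w),
          if (t : ℕ) < (w.take ((l : ℕ) + 1)).sum then z (Fin.natAdd 0 t) else 1))) *
        ∏ a : Fin 0, 1 / (1 - z (Fin.castAdd (MZV.weight w) a))) r.domain) ∧
    ∀ (r : KZ.IntegralRep (0 + MZV.weight w)),
      r.domain = {z : Fin (0 + MZV.weight w) → ℝ |
        (∀ i : Fin (MZV.weight w), z (Fin.natAdd 0 i) ∈ Set.Ioo (0:ℝ) 1) ∧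
        (∀ a : Fin 0, z (Fin.castAdd (MZV.weight w) a) ∈ Set.Ioo (0:ℝ) 1) ∧
        (∀ a b : Fin 0, a < b → z (Fin.castAdd (MZV.weight w) a) < z (Fin.castAdd (MZV.weight w) b)) ∧
        (∀ a : Fin 0, (a : ℕ) + 1 = 0 → ∀ i : Fin (MZV.weight w), (i : ℕ) = (w.take m).sum →
          z (Fin.castAdd (MZV.weight w) a) < z (Fin.natAdd 0 i))} →
      Set.EqOn r.integrand (fun z => (∏ l : Fin w.length,
        (∏ t : Fin (MZV.weight w), if (t : ℕ) < (w.take l).sum then z (Fin.natAdd 0 t) else 1) /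
        (1 - (∏ t : Fin (MZV.weight w),
          if (t : ℕ) < (w.take ((l : ℕ) + 1)).sum then z (Fin.natAdd 0 t) else 1))) *
        ∏ a : Fin 0, 1 / (1 - z (Fin.castAdd (MZV.weight w) a))) r.domain →
      KZ.of r - Z w ∈ KZ.relations := by
  have hT := stub_cubicalTransport w hw hne (fun x => ∏ l : Fin w.length,
    (∏ t : Fin (MZV.weight w), if (t : ℕ) < (w.take l).sum then x t else 1) /
    (1 - (∏ t : Fin (MZV.weight w), if (t : ℕ) < (w.take ((l : ℕ) + 1)).sum then x t else 1)))
    (fun _ => rfl)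
  obtain ⟨r₀, hr₀d, hr₀i⟩ := hT.1
  have hequiv := hT.2.1
  -- the reindexing `Fin n ≃ Fin (0 + n)`
  let e : Fin (MZV.weight w) ≃ Fin (0 + MZV.weight w) := finCongr (Nat.zero_add _).symm
  have he : ∀ i : Fin (MZV.weight w), e i = Fin.natAdd 0 i := fun i => by ext; simp [e]
  have hdom : (r₀.reindex e).domain = {z : Fin (0 + MZV.weight w) → ℝ |
      (∀ i : Fin (MZV.weight w), z (Fin.natAdd 0 i) ∈ Set.Ioo (0:ℝ) 1) ∧
      (∀ a : Fin 0, z (Fin.castAdd (MZV.weight w) a) ∈ Set.Ioo (0:ℝ) 1) ∧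
      (∀ a b : Fin 0, a < b → z (Fin.castAdd (MZV.weight w) a) < z (Fin.castAdd (MZV.weight w) b)) ∧
      (∀ a : Fin 0, (a : ℕ) + 1 = 0 → ∀ i : Fin (MZV.weight w), (i : ℕ) = (w.take m).sum →
        z (Fin.castAdd (MZV.weight w) a) < z (Fin.natAdd 0 i))} := by
    rw [KZ.IntegralRep.reindex_domain, hr₀d]
    ext z
    simp only [Set.mem_setOf_eq, he, IsEmpty.forall_iff, and_true]
  have hint : ∀ z : Fin (0 + MZV.weight w) → ℝ, z ∈ (r₀.reindex e).domain →
      (r₀.reindex e).integrand z = (∏ l : Fin w.length,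
        (∏ t : Fin (MZV.weight w), if (t : ℕ) < (w.take l).sum then z (Fin.natAdd 0 t) else 1) /
        (1 - (∏ t : Fin (MZV.weight w),
          if (t : ℕ) < (w.take ((l : ℕ) + 1)).sum then z (Fin.natAdd 0 t) else 1))) *
        ∏ a : Fin 0, 1 / (1 - z (Fin.castAdd (MZV.weight w) a)) := by
    intro z hz
    rw [KZ.IntegralRep.reindex_integrand]
    show r₀.integrand (fun i => z (e i)) = _
    rw [hr₀i hz]
    simp only [he, Finset.univ_eq_empty, Finset.prod_empty, mul_one]
  refine ⟨⟨r₀.reindex e, hdom, fun z hz => hint z hz⟩, fun r hrd hri => ?_⟩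
  have h1 : KZ.of r - KZ.of (r₀.reindex e) ∈ KZ.relations :=
    KZ.of_sub_of_mem_relations_of_eqOn (hdom.trans hrd.symm) fun z hz => by
      have hz' : z ∈ (r₀.reindex e).domain := by rw [hdom, ← hrd]; exact hz
      rw [hri hz, hint z hz']
  have h2 : KZ.of r₀ - KZ.of (r₀.reindex e) ∈ KZ.relations := KZ.of_sub_of_reindex_mem_relations r₀ e
  have h3 : KZ.of r₀ - Z w ∈ KZ.relations := by
    rw [hZ w hw]; exact hequiv r₀ ⟨hr₀d, hr₀i⟩
  have : KZ.of r - Z w = (KZ.of r - KZ.of (r₀.reindex e)) - (KZ.of r₀ - KZ.of (r₀.reindex e)) +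
      (KZ.of r₀ - Z w) := by abel
  rw [this]
  exact KZ.relations.add_mem (KZ.relations.sub_mem h1 h2) h3

/-! ### The induction -/

/-- **The rider induction.** For every `Z` pinned to Kontsevich's simplex classes, every number of
riders `j`, every non-empty admissible `w` and block `m < k`: the mixed representation
`C_j(w, m)` exists, and every representation of that shape is congruent modulo `KZ.relations` to the
star–stuffle form `Σ_{c ∈ (1^{j+1})⋆} Σ_{v ∈ w_{>m} ∗ c.tail} Z(w_{<m} ++ (w_m − 1 + c₁) :: v)` of its
series (base `rider_base`; step `rider_step` with the family of representations chosen from the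
induction hypothesis, and `star_step_identity`). [cite: KanekoYamamoto2018, Thm 4.1] -/
theorem rider_induction (Z : List ℕ → KZ.FormalRep)
    (hZ : ∀ (u : List ℕ) (hu : MZV.IsAdmissible u), Z u = KZ.of (KZ.mzvRep u hu
      (KZ.mzvIntegrand_isSemialgebraicFunOn_holds u) (KZ.mzvIntegrand_integrableOn_holds u hu))) :
    ∀ (j : ℕ) (w : List ℕ), MZV.IsAdmissible w → w ≠ [] → ∀ (m : ℕ), m < w.length →
    (∃ r : KZ.IntegralRep (j + MZV.weight w),
      r.domain = {z : Fin (j + MZV.weight w) → ℝ |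
        (∀ i : Fin (MZV.weight w), z (Fin.natAdd j i) ∈ Set.Ioo (0:ℝ) 1) ∧
        (∀ a : Fin j, z (Fin.castAdd (MZV.weight w) a) ∈ Set.Ioo (0:ℝ) 1) ∧
        (∀ a b : Fin j, a < b → z (Fin.castAdd (MZV.weight w) a) < z (Fin.castAdd (MZV.weight w) b)) ∧
        (∀ a : Fin j, (a : ℕ) + 1 = j → ∀ i : Fin (MZV.weight w), (i : ℕ) = (w.take m).sum →
          z (Fin.castAdd (MZV.weight w) a) < z (Fin.natAdd j i))} ∧
      Set.EqOn r.integrand (fun z => (∏ l : Fin w.length,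
        (∏ t : Fin (MZV.weight w), if (t : ℕ) < (w.take l).sum then z (Fin.natAdd j t) else 1) /
        (1 - (∏ t : Fin (MZV.weight w),
          if (t : ℕ) < (w.take ((l : ℕ) + 1)).sum then z (Fin.natAdd j t) else 1))) *
        ∏ a : Fin j, 1 / (1 - z (Fin.castAdd (MZV.weight w) a))) r.domain) ∧
    ∀ r : KZ.IntegralRep (j + MZV.weight w),
      r.domain = {z : Fin (j + MZV.weight w) → ℝ |
        (∀ i : Fin (MZV.weight w), z (Fin.natAdd j i) ∈ Set.Ioo (0:ℝ) 1) ∧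
        (∀ a : Fin j, z (Fin.castAdd (MZV.weight w) a) ∈ Set.Ioo (0:ℝ) 1) ∧
        (∀ a b : Fin j, a < b → z (Fin.castAdd (MZV.weight w) a) < z (Fin.castAdd (MZV.weight w) b)) ∧
        (∀ a : Fin j, (a : ℕ) + 1 = j → ∀ i : Fin (MZV.weight w), (i : ℕ) = (w.take m).sum →
          z (Fin.castAdd (MZV.weight w) a) < z (Fin.natAdd j i))} →
      Set.EqOn r.integrand (fun z => (∏ l : Fin w.length,
        (∏ t : Fin (MZV.weight w), if (t : ℕ) < (w.take l).sum then z (Fin.natAdd j t) else 1) /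
        (1 - (∏ t : Fin (MZV.weight w),
          if (t : ℕ) < (w.take ((l : ℕ) + 1)).sum then z (Fin.natAdd j t) else 1))) *
        ∏ a : Fin j, 1 / (1 - z (Fin.castAdd (MZV.weight w) a))) r.domain →
      KZ.of r - ((starIndices (List.replicate (j + 1) 1)).map fun c =>
        sumStuffle (fun v => Z (w.take m ++ (w.getD m 0 - 1 + c.headD 0) :: v)) (w.drop (m + 1)) c.tail).sum ∈
        KZ.relations
  | 0, w, hw, hne, m, hm => by
    obtain ⟨hex, hrel⟩ := rider_base Z hZ w hw hne m
    refine ⟨hex, fun r hrd hri => ?_⟩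
    have hG : ((starIndices (List.replicate (0 + 1) 1)).map fun c =>
        sumStuffle (fun v => Z (w.take m ++ (w.getD m 0 - 1 + c.headD 0) :: v)) (w.drop (m + 1)) c.tail).sum =
        Z w := by
      have h1 : 1 ≤ w.getD m 0 := by
        rw [List.getD_eq_getElem _ _ hm]; exact hw.1 _ (List.getElem_mem hm)
      have hw' : w.take m ++ (w.getD m 0 - 1 + 1) :: w.drop (m + 1) = w := by
        rw [Nat.sub_add_cancel h1, List.getD_eq_getElem _ _ hm, ← List.drop_eq_getElem_cons hm,
          List.take_append_drop]
      rw [show List.replicate (0 + 1) 1 = [1] from rfl, MZV.starIndices_singleton, List.map_cons,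
        List.map_nil, List.sum_cons, List.sum_nil, add_zero, List.headD_cons, List.tail_cons,
        MZV.sumStuffle_nil_right, hw']
    rw [hG]
    exact hrel r hrd hri
  | j + 1, w, hw, hne, m, hm => by
    classical
    -- the family chosen from the induction hypothesis
    let C : List ℕ → ℕ → KZ.FormalRep := fun w' m' =>
      if h : MZV.IsAdmissible w' ∧ w' ≠ [] ∧ m' < w'.length then
        KZ.of (Classical.choose (rider_induction Z hZ j w' h.1 h.2.1 m' h.2.2).1) else 0
    have hCdef : ∀ (w' : List ℕ) (hw' : MZV.IsAdmissible w') (hne' : w' ≠ []) (m' : ℕ)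
        (hm' : m' < w'.length),
        C w' m' = KZ.of (Classical.choose (rider_induction Z hZ j w' hw' hne' m' hm').1) := by
      intro w' hw' hne' m' hm'
      show (if h : MZV.IsAdmissible w' ∧ w' ≠ [] ∧ m' < w'.length then
        KZ.of (Classical.choose (rider_induction Z hZ j w' h.1 h.2.1 m' h.2.2).1) else 0) = _
      rw [dif_pos ⟨hw', hne', hm'⟩]
    have hC : ∀ (w' : List ℕ), MZV.IsAdmissible w' → w' ≠ [] → ∀ (m' : ℕ), m' < w'.length →
        ∃ r : KZ.IntegralRep (j + MZV.weight w'),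
          r.domain = {z : Fin (j + MZV.weight w') → ℝ |
            (∀ i : Fin (MZV.weight w'), z (Fin.natAdd j i) ∈ Set.Ioo (0:ℝ) 1) ∧
            (∀ a : Fin j, z (Fin.castAdd (MZV.weight w') a) ∈ Set.Ioo (0:ℝ) 1) ∧
            (∀ a b : Fin j, a < b → z (Fin.castAdd (MZV.weight w') a) < z (Fin.castAdd (MZV.weight w') b)) ∧
            (∀ a : Fin j, (a : ℕ) + 1 = j → ∀ i : Fin (MZV.weight w'), (i : ℕ) = (w'.take m').sum →
              z (Fin.castAdd (MZV.weight w') a) < z (Fin.natAdd j i))} ∧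
          Set.EqOn r.integrand (fun z => (∏ l : Fin w'.length,
            (∏ t : Fin (MZV.weight w'), if (t : ℕ) < (w'.take l).sum then z (Fin.natAdd j t) else 1) /
            (1 - (∏ t : Fin (MZV.weight w'),
              if (t : ℕ) < (w'.take ((l : ℕ) + 1)).sum then z (Fin.natAdd j t) else 1))) *
            ∏ a : Fin j, 1 / (1 - z (Fin.castAdd (MZV.weight w') a))) r.domain ∧
          C w' m' = KZ.of r := by
      intro w' hw' hne' m' hm'
      have hspec := Classical.choose_spec (rider_induction Z hZ j w' hw' hne' m' hm').1
      exact ⟨_, hspec.1, hspec.2, hCdef w' hw' hne' m' hm'⟩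
    obtain ⟨hex, hstep⟩ := rider_step w hw hne hm j C hC
    refine ⟨hex, fun r hrd hri => ?_⟩
    have h1 := hstep r hrd hri
    -- each chosen representation is congruent to its star–stuffle form (induction hypothesis)
    have hIH : ∀ (w' : List ℕ) (hw' : MZV.IsAdmissible w') (hne' : w' ≠ []) (m' : ℕ)
        (hm' : m' < w'.length),
        C w' m' - ((starIndices (List.replicate (j + 1) 1)).map fun c =>
          sumStuffle (fun v => Z (w'.take m' ++ (w'.getD m' 0 - 1 + c.headD 0) :: v)) (w'.drop (m' + 1))
            c.tail).sum ∈ KZ.relations := by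
      intro w' hw' hne' m' hm'
      have hspec := Classical.choose_spec (rider_induction Z hZ j w' hw' hne' m' hm').1
      rw [hCdef w' hw' hne' m' hm']
      exact (rider_induction Z hZ j w' hw' hne' m' hm').2 _ hspec.1 hspec.2
    have hw1 : ∀ a ∈ w, 1 ≤ a := hw.1
    have hCr : ∀ i ∈ Finset.Ico m w.length,
        C (w.take i ++ [w.getD i 0 + 1] ++ w.drop (i + 1)) i -
          ((starIndices (List.replicate (j + 1) 1)).map fun c =>
            sumStuffle (fun v => Z (w.take i ++ (w.getD i 0 + c.headD 0) :: v)) (w.drop (i + 1)) c.tail).sum ∈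
          KZ.relations := by
      intro i hi
      have hi' : i < w.length := (Finset.mem_Ico.mp hi).2
      have hadm : MZV.IsAdmissible (w.take i ++ [w.getD i 0 + 1] ++ w.drop (i + 1)) :=
        Summit.KontsevichZagierPeriods.HoffmanRelationInKZ.Negative.isAdmissible_raise hw hi'
      have h := hIH (w.take i ++ [w.getD i 0 + 1] ++ w.drop (i + 1)) hadm
        (by simp) i (by rw [length_raise' w i hi']; exact hi')
      simp only [take_raise w hi', getD_raise w hi', drop_raise w hi', Nat.add_sub_cancel] at h
      exact h
    have hCh : ∀ i ∈ Finset.Ico m w.length,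
        C (w.take (i + 1) ++ [1] ++ w.drop (i + 1)) (i + 1) -
          ((starIndices (List.replicate (j + 1) 1)).map fun c =>
            sumStuffle (fun v => Z (w.take (i + 1) ++ (0 + c.headD 0) :: v)) (w.drop (i + 1)) c.tail).sum ∈
          KZ.relations := by
      intro i hi
      have hi' : i < w.length := (Finset.mem_Ico.mp hi).2
      have hadm : MZV.IsAdmissible (w.take (i + 1) ++ [1] ++ w.drop (i + 1)) := by
        obtain ⟨b, t, rfl⟩ := List.exists_cons_of_ne_nil hne
        refine ⟨fun x hx => ?_, fun _ => ?_⟩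
        · simp only [List.mem_append, List.mem_singleton] at hx
          rcases hx with (hx | rfl) | hx
          · exact hw.1 x (List.mem_of_mem_take hx)
          · exact le_rfl
          · exact hw.1 x (List.mem_of_mem_drop hx)
        · simpa using hw.2 (List.cons_ne_nil b t)
      have h := hIH (w.take (i + 1) ++ [1] ++ w.drop (i + 1)) hadm (by simp) (i + 1)
        (by rw [length_insertOne w i hi']; omega)
      simp only [take_ins w hi', getD_ins w hi', drop_ins w hi', Nat.sub_self] at h
      exact h
    rw [star_step_identity Z j w hw1 hm]
    have key : KZ.of r - ∑ i ∈ Finset.Ico m w.length,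
        (((starIndices (List.replicate (j + 1) 1)).map fun c =>
            sumStuffle (fun v => Z (w.take i ++ (w.getD i 0 + c.headD 0) :: v)) (w.drop (i + 1)) c.tail).sum +
          ((starIndices (List.replicate (j + 1) 1)).map fun c =>
            sumStuffle (fun v => Z (w.take (i + 1) ++ (0 + c.headD 0) :: v)) (w.drop (i + 1)) c.tail).sum) =
      (KZ.of r - ∑ i ∈ Finset.Ico m w.length,
        (C (w.take i ++ [w.getD i 0 + 1] ++ w.drop (i + 1)) i +
          C (w.take (i + 1) ++ [1] ++ w.drop (i + 1)) (i + 1))) +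
      ∑ i ∈ Finset.Ico m w.length,
        ((C (w.take i ++ [w.getD i 0 + 1] ++ w.drop (i + 1)) i -
          ((starIndices (List.replicate (j + 1) 1)).map fun c =>
            sumStuffle (fun v => Z (w.take i ++ (w.getD i 0 + c.headD 0) :: v)) (w.drop (i + 1)) c.tail).sum) +
        (C (w.take (i + 1) ++ [1] ++ w.drop (i + 1)) (i + 1) -
          ((starIndices (List.replicate (j + 1) 1)).map fun c =>
            sumStuffle (fun v => Z (w.take (i + 1) ++ (0 + c.headD 0) :: v)) (w.drop (i + 1)) c.tail).sum)) := by
      simp only [Finset.sum_add_distrib, Finset.sum_sub_distrib]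
      abel
    rw [key]
    exact KZ.relations.add_mem h1 (KZ.relations.sum_mem fun i hi =>
      KZ.relations.add_mem (hCr i hi) (hCh i hi))

/-! ### The integral–series family and the proof of `DoubleShuffleInKZ` -/


/-- **The Kaneko–Yamamoto integral–series family inside the KZ module.**  For every pinned family
`Z` of Kontsevich simplex representations, every admissible `(b+1) ∷ t` and every `j ≥ 1`,
`Σ_{w ∈ yʲ ш tail(bw((b+1)∷t))} Z(x w) − Σ_{c ∈ (1^{j+1})^⋆} sumStuffle (Z ((b + c₀) ∷ ·)) t c.tail
∈ KZ.relations`.  [cite: KanekoYamamoto2018, Thm 4.1] (proved here geometrically, inside the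
Kontsevich–Zagier calculus). -/
theorem integralSeriesFamily (Z : List ℕ → KZ.FormalRep)
    (hZ : ∀ (u : List ℕ) (hu : MZV.IsAdmissible u), Z u = KZ.of (KZ.mzvRep u hu
      (KZ.mzvIntegrand_isSemialgebraicFunOn_holds u) (KZ.mzvIntegrand_integrableOn_holds u hu)))
    (b : ℕ) (t : List ℕ) (hbt : MZV.IsAdmissible ((b + 1) :: t)) (j : ℕ) (hj : 1 ≤ j) :
    ((MZV.shuffleWord (List.replicate j true) (MZV.binaryWord ((b + 1) :: t)).tail).map
        fun w => Z (MZV.ofBinaryWord (false :: w))).sum -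
      ((starIndices (List.replicate (j + 1) 1)).map fun c =>
        sumStuffle (fun w => Z ((b + c.headD 0) :: w)) t c.tail).sum ∈ KZ.relations := by
  have hj0 : 0 < j := hj
  have hb : 1 ≤ b := by have := hbt.2 (List.cons_ne_nil _ _); simp at this; omega
  -- the mixed representation `C_j((b+1)∷t, 0)` and the stuffle side
  obtain ⟨⟨r, hrd, hri⟩, hrel⟩ :=
    rider_induction Z hZ j ((b + 1) :: t) hbt (List.cons_ne_nil _ _) 0 (by simp)
  have hG := hrel r hrd hri
  simp only [List.take_zero, List.nil_append, List.getD_cons_zero, Nat.add_sub_cancel, zero_add,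
    List.drop_one, List.tail_cons] at hG
  -- the `Λ`-poset representation and the shuffle side
  set c : ℕ := b + t.sum with hc_def
  have hc0 : 0 < c := by omega
  have hc : MZV.weight ((b + 1) :: t) = c + 1 := by
    simp only [MZV.weight, List.sum_cons, hc_def]; omega
  have hlen : (MZV.binaryWord ((b + 1) :: t)).length = c + 1 := by
    rw [MZV.length_binaryWord hbt.1, hc]
  have hlast : (MZV.binaryWord ((b + 1) :: t)).getD ((⟨c - 1, Nat.sub_one_lt_of_lt hc0⟩ : Fin c) + 1)
      false = true := by
    rw [Fin.val_mk, Nat.sub_add_cancel hc0, List.getD_eq_getElem?_getD]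
    have h := MZV.getLast?_binaryWord (List.cons_ne_nil (b + 1) t)
    rw [List.getLast?_eq_getElem?, hlen, Nat.add_sub_cancel] at h
    rw [h]; rfl
  obtain ⟨⟨r', hr'd, hr'i⟩, hrel'⟩ := lambda_cells Z hZ j c hj0 hc0
    (fun i : Fin c => (MZV.binaryWord ((b + 1) :: t)).getD ((i : ℕ) + 1) false) hlast
  have hΛ := hrel' r' hr'd (fun z _ => by rw [hr'i])
  have hofFn : List.ofFn (fun i : Fin c => (MZV.binaryWord ((b + 1) :: t)).getD ((i : ℕ) + 1) false) =
      (MZV.binaryWord ((b + 1) :: t)).tail := by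
    apply List.ext_getElem
    · rw [List.length_ofFn, List.length_tail, hlen, Nat.add_sub_cancel]
    · intro i h1 h2
      rw [List.length_ofFn] at h1
      rw [List.getElem_ofFn, List.getElem_tail, List.getD_eq_getElem _ _ (by rw [hlen]; omega)]
  rw [hofFn] at hΛ
  -- the chart between them
  have hchart := lambda_chart ((b + 1) :: t) hbt (List.cons_ne_nil _ _) j c (MZV.weight ((b + 1) :: t))
    hj0 hc0 rfl hc r hrd hri r' hr'd (fun z _ => by rw [hr'i])
  have h := KZ.relations.sub_mem (KZ.relations.sub_mem hG hchart) hΛ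
  convert h using 1
  abel

/-- **`DoubleShuffleInKZ` holds** (support item stmt-KontsevichZagierPeriods-14665 of the route
`FurushoPentagon`): Racinet's generalised double shuffle relations for the image of the
shuffle-regularised MZV series under every `χ : KZ.FormalRep →+ R` killing `KZ.relations`,
multiplicative and with `1` in its image.  Immediate from the Kaneko–Yamamoto family
`integralSeriesFamily` and the reduction `IntegralSeries.doubleShuffleInKZ_of_integralSeriesFamily`.
[cite: KanekoYamamoto2018, Thm 4.1; IharaKanekoZagier2006, Thm 2] -/
theorem doubleShuffleInKZ_proof :
    Summit.KontsevichZagierPeriods.KontsevichZagierPeriods.Theses.FurushoPentagon.DoubleShuffleInKZ :=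
  IntegralSeries.doubleShuffleInKZ_of_integralSeriesFamily
    fun Z hZ b t hbt j hj => integralSeriesFamily Z hZ b t hbt j hj

end Summit.KontsevichZagierPeriods.FurushoPentagon.DoubleShuffleInKZ
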